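import Summits.CriticalPhenomena.SAWScalingLimit.Theses.SAWInfinitesimalRigidity
import Literature.Probability.RandomPlanarGeometry.ChordalReversibility
import Literature.Probability.RandomPlanarGeometry.LatticeSimilarityCovariance
import Literature.Probability.RandomPlanarGeometry.ChordalRestrictionMarkov
import Literature.Probability.RandomPlanarGeometry.ConformalRestrictionProofs

/-!
# Line `birth` — registered skeleton for the crux `GlobalFromLocal` (stmt-CriticalPhenomena-4617)

Crux (FIXED; rank 4 of `route-CriticalPhenomena-SAWInfinitesimalRigidity`, the route's "honest global
residue"): `GlobalFromLocal := LocalRigidity → R*`, where R* (stmt-CriticalPhenomena-1368 verbatim) says that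
every chordal family `P` with the LATTICE-EXACT axioms — chordal, two-sided restriction, a restriction-coupled
domain Markov kernel, reversibility, covariance under `z ↦ r·iᵏ·z + w` and under conjugation, carried by simple
boundary-avoiding curves — is conformally covariant (hence SLE(8/3) by Lawler–Schramm–Werner 2003), and
`LocalRigidity` (stmt-CriticalPhenomena-4616) says this holds for the lattice-exact `P` whose sub-domain avoidance
probabilities are uniformly `ε`-close to those of an SLE(8/3) family `F` (`ε = ε(F) > 0`).

## The cut: OPEN + CHAIN-CONNECTED ⇒ EVERYTHING (the local-to-global template, made literal)

`GlobalFromLocal` is literally "local rigidity ⇒ global rigidity". The one classical bridge between the two is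
connectedness: in a chain-connected space a non-empty set that absorbs an `ε`-neighbourhood of itself, with `ε`
UNIFORM, is everything. The skeleton types the two halves over tree vocabulary (`ChordalFamily.IsRestrictionMarkov`,
`IsReversible`, `IsLatticeSimilarityCovariant`, `IsCarriedBySimpleCurves` are `Iff.rfl`-equal to the clauses the
route inlines; the closeness clause is `LocalRigidity`'s own, verbatim):

* S1 `stub_uniformLocalRigidity` (M; provable from the tree GIVEN the crux's own hypothesis `LocalRigidity`) —
  UNIFORM ABSORPTION AT THE COVARIANT LOCUS: `LocalRigidity → ∃ ε > 0` such that every lattice-exact `P` whose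
  avoidance probabilities are `ε`-close (sup over nested Dobrushin pairs, same marked points) to those of a
  chordal, conformally covariant, restriction, simple family `F` is conformally covariant. Content beyond
  `LocalRigidity`: the base point is quantified AFTER `ε` (uniformity) and is any covariant exact family rather
  than a named SLE(8/3) family. Route: such an `F` is SLE(8/3) in every domain
  (`LawlerSchrammWerner2003_holds`, PROVED in the tree), SLE(8/3) laws are unique
  (`IsSLELaw.unique` + `IsSLECurve.map_eq_holds`, or `LawlerSchrammWerner2003_unique_holds`), so by `funext`
  there is AT MOST ONE such `F₀ : ChordalFamily`; take `ε := ε(F₀)` from `LocalRigidity` (and `ε := 1`,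
  vacuously, if no covariant exact family exists).
* S2 `stub_chainFromCovariant` (open-problem sized; the HARDEST, load-bearing stub — the global content) —
  `ε`-CHAIN CONNECTEDNESS OF THE LATTICE-EXACT CLASS TO ITS COVARIANT LOCUS: for every `ε > 0` and every
  lattice-exact `P` there is a finite chain `c 0, …, c n = P` of lattice-exact families, `c 0` conformally
  covariant, consecutive members `ε`-close in the avoidance sense (`c (i+1)` measured against `c i`). This is
  where a MECHANISM must enter (a homotopy / continuation inside the exact class — e.g. the endpoint-pinning
  role the route header assigns to the continuation cards — discretised by uniform continuity gives chains for
  every `ε`); it is strictly weaker than R* for each fixed `ε` (R* gives the trivial chain `n = 0`, `c 0 = P`), and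
  it does NOT give R* without S1.

`GlobalFromLocal_of` (kernel-checked, no `sorry` of its own): given `LocalRigidity`, take `ε` from S1, the chain
from S2, and run the induction `i ↦ i + 1` along the chain (each step is one application of S1 with
`F := c i`, `P := c (i+1)`); at `i = n` the family `P` itself is conformally covariant. Hypotheses = the two stubs
under their registered names (`Registered.stub_…`), conclusion = the route decl
`Summit.CriticalPhenomena.SAWScalingLimit.Theses.SAWInfinitesimalRigidity.GlobalFromLocal` BY NAME.

Nothing is lost by the cut: `GlobalFromLocal ∧ LocalRigidity ⇒ S1 ∧ S2` (R* makes S1's conclusion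
unconditional and S2's chain trivial) and `S1 ∧ S2 ⇒ GlobalFromLocal` (this file).

## Disproof / negatives used
* `Cruxes/GlobalFromLocal/Disproof.lean`: none exists (`ledger crux ls stmt-CriticalPhenomena-4617`: no
  workfiles at registration, 2026-08-17) — no `_false_without_` obstruction to honour yet.
* `ledger negatives --problem CriticalPhenomena` (11 entries, 2026-08-17): the only symmetry-upgrade negative
  is stmt-0698 (`not_SymmetryUpgrade`, LOCALITY families: the fat-germ one-shot surgery of SLE₆ is similarity
  covariant, Markov, local, target independent). Neither stub is an instance: both quantify over families with
  EXACT TWO-SIDED RESTRICTION, reversibility and a.s. SIMPLE boundary-avoiding curves (a surgery that inserts a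
  deterministic straight initial phase on a sub-class of domains breaks restriction from any un-surgered
  super-domain with the same marked points), and S1 only upgrades `ε`-NEAR the covariant locus.
* Vacuity pass: S2 is not vacuous (the SLE(8/3) family is lattice-exact and covariant — LSW03 restriction,
  reversibility, the slit-domain Markov kernel) and has no trivial witness for small `ε` (for `ε ≥ 1` the
  two-point chain works since avoidance probabilities lie in `[0,1]` — harmless, the composition uses the `ε`
  of S1); S1 is vacuous only if `LocalRigidity` fails or no covariant exact family exists, exactly the cases in
  which the crux itself is vacuous.
-/

noncomputable section

open MeasureTheory Filter Topology Set
open Literature.Probability.RandomPlanarGeometry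
open Summit.CriticalPhenomena.SAWScalingLimit.Theses

namespace Summit.CriticalPhenomena.SAWScalingLimit.Cruxes.GlobalFromLocal.Birth

/-! ### Vocabulary of the line (documentation; the registered stubs spell these out over tree declarations) -/

/-- The **lattice-exact axioms** on one chordal family `P` — the hypotheses of R*
(stmt-CriticalPhenomena-1368) / of `LocalRigidity`, bundled with the tree's named predicates
(`isRestrictionMarkov_iff`, `isReversible_iff`, `isLatticeSimilarityCovariant_iff` are `Iff.rfl`;
`IsCarriedBySimpleCurves` is the simplicity clause verbatim). -/
def IsLatticeExact (P : ChordalFamily) : Prop :=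
  P.IsChordal ∧ P.IsRestriction ∧ P.IsRestrictionMarkov ∧ P.IsReversible ∧
    P.IsLatticeSimilarityCovariant ∧ P.IsCarriedBySimpleCurves

/-- **`ε`-closeness in the avoidance sense** (the topology of `LocalRigidity`, verbatim): the sub-domain
avoidance probabilities `P D {γ ⊆ cl D'}` of `P` are within `ε` of those of the reference family `F`,
uniformly over nested Dobrushin pairs `D' ⊆ D` with the same marked points. -/
def AvoidanceClose (ε : ℝ) (P F : ChordalFamily) : Prop :=
  ∀ D D' : DobrushinDomain, D'.carrier ⊆ D.carrier → D'.pt 0 = D.pt 0 → D'.pt 1 = D.pt 1 →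
    |(P D (CurveClass.rangeSubset (closure D'.carrier))).toReal -
        (F D (CurveClass.rangeSubset (closure D'.carrier))).toReal| ≤ ε

/-- **S1, named.** Uniform absorption at the covariant locus, from `LocalRigidity`. -/
def UniformLocalRigidity : Prop :=
  SAWInfinitesimalRigidity.LocalRigidity →
    ∃ ε : ℝ, 0 < ε ∧ ∀ P F : ChordalFamily,
      F.IsChordal → F.IsConformallyCovariant → F.IsRestriction → F.IsCarriedBySimpleCurves →
      IsLatticeExact P → AvoidanceClose ε P F → P.IsConformallyCovariant

/-- **S2, named.** `ε`-chain connectedness of the lattice-exact class to its covariant locus. -/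
def ChainFromCovariant : Prop :=
  ∀ ε : ℝ, 0 < ε → ∀ P : ChordalFamily, IsLatticeExact P →
    ∃ (n : ℕ) (c : ℕ → ChordalFamily), (c 0).IsConformallyCovariant ∧ c n = P ∧
      (∀ i, i ≤ n → IsLatticeExact (c i)) ∧ ∀ i, i < n → AvoidanceClose ε (c (i + 1)) (c i)

/-! ### The stubs (the ONLY `sorry`s of this file)

Stated over TREE VOCABULARY ONLY (the named statements above unfolded by hand), so that each lands verbatim
as a `Theorems/SAWInfinitesimalRigidityGlobalFromLocal<Stub>.lean --supports stmt-CriticalPhenomena-4617`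
without importing this workfile (provers: `open MeasureTheory Literature.Probability.RandomPlanarGeometry
Summit.CriticalPhenomena.SAWScalingLimit.Theses` makes the registered signature text elaborate verbatim). -/

/-- **S1 — uniform local rigidity at the covariant locus.** `LocalRigidity` gives, for each SLE(8/3) family
`F`, an `ε(F) > 0` absorbing the `ε(F)`-close lattice-exact families into the covariant locus; here `ε` is
chosen FIRST and the base point is ANY chordal, conformally covariant, restriction, simple family `F`. Proof
route (tree only): `F` is SLE(8/3) in every domain (`LawlerSchrammWerner2003_holds`), SLE(8/3) laws are unique
(`IsSLELaw.unique`, `IsSLECurve.map_eq_holds`; or `LawlerSchrammWerner2003_unique_holds` with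
`IsRestriction.isHullRestriction`), hence by `funext` at most one such `F₀` exists and `ε := ε(F₀)` works
(`ε := 1` vacuously if there is none). Size M. -/
theorem stub_uniformLocalRigidity :
    SAWInfinitesimalRigidity.LocalRigidity →
      ∃ ε : ℝ, 0 < ε ∧ ∀ P F : ChordalFamily,
        F.IsChordal → F.IsConformallyCovariant → F.IsRestriction → F.IsCarriedBySimpleCurves →
        P.IsChordal → P.IsRestriction → P.IsRestrictionMarkov → P.IsReversible →
        P.IsLatticeSimilarityCovariant → P.IsCarriedBySimpleCurves →
        (∀ D D' : DobrushinDomain, D'.carrier ⊆ D.carrier → D'.pt 0 = D.pt 0 → D'.pt 1 = D.pt 1 →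
          |(P D (CurveClass.rangeSubset (closure D'.carrier))).toReal -
              (F D (CurveClass.rangeSubset (closure D'.carrier))).toReal| ≤ ε) →
        P.IsConformallyCovariant := by
  sorry

/-- **S2 (hardest) — `ε`-chain connectedness of the lattice-exact class to its covariant locus.** For every
`ε > 0` and every lattice-exact `P` there is a finite chain `c 0, c 1, …, c n = P` of lattice-exact families
with `c 0` conformally covariant and `c (i+1)` `ε`-close to `c i` in the avoidance sense for all `i < n`.
Why plausibly true: if R* holds it is trivial (`n = 0`); independently of R*, any continuous path inside the
exact class from the covariant locus to `P` (a continuation / homotopy of exact families — the mechanism this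
stub asks for) yields chains for every `ε` by uniform continuity. Why it might fail: an exotic lattice-exact
family in a chain-component of its own (the crux's why-might-fail, sharpened: isolation FROM the covariant
locus, not mere existence). Size: open-problem. -/
theorem stub_chainFromCovariant :
    ∀ ε : ℝ, 0 < ε → ∀ P : ChordalFamily,
      P.IsChordal → P.IsRestriction → P.IsRestrictionMarkov → P.IsReversible →
      P.IsLatticeSimilarityCovariant → P.IsCarriedBySimpleCurves →
      ∃ (n : ℕ) (c : ℕ → ChordalFamily),
        (c 0).IsConformallyCovariant ∧ c n = P ∧
        (∀ i : ℕ, i ≤ n →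
          (c i).IsChordal ∧ (c i).IsRestriction ∧ (c i).IsRestrictionMarkov ∧ (c i).IsReversible ∧
            (c i).IsLatticeSimilarityCovariant ∧ (c i).IsCarriedBySimpleCurves) ∧
        ∀ i : ℕ, i < n → ∀ D D' : DobrushinDomain, D'.carrier ⊆ D.carrier → D'.pt 0 = D.pt 0 →
          D'.pt 1 = D.pt 1 →
          |(c (i + 1) D (CurveClass.rangeSubset (closure D'.carrier))).toReal -
              (c i D (CurveClass.rangeSubset (closure D'.carrier))).toReal| ≤ ε := by
  sorry

/-! ### Consistency: each named statement IS its registered stub (definitionally) -/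

theorem uniformLocalRigidity_holds : UniformLocalRigidity :=
  fun hLR => by
    obtain ⟨ε, hε, h⟩ := stub_uniformLocalRigidity hLR
    exact ⟨ε, hε, fun P F hF hFcc hFres hFs hP hcl =>
      h P F hF hFcc hFres hFs hP.1 hP.2.1 hP.2.2.1 hP.2.2.2.1 hP.2.2.2.2.1 hP.2.2.2.2.2 hcl⟩

theorem chainFromCovariant_holds : ChainFromCovariant :=
  fun ε hε P hP => stub_chainFromCovariant ε hε P hP.1 hP.2.1 hP.2.2.1 hP.2.2.2.1 hP.2.2.2.2.1 hP.2.2.2.2.2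

/-! ### Name-keyed aliases of the two statements — the hypotheses of `GlobalFromLocal_of`

The native skeleton audit (`#h21_check_skeleton`) admits a hypothesis of the skeleton theorem only if its head
constant is a registered obligation or is NAMED like a declared stub; `Registered.stub_X` is the statement of
`stub_X` under that name (device of `Cruxes/AxiomsOfLimit/Lines/birth.lean`, `Cruxes/ChainLaw/Lines/birth.lean`).
Each alias unfolds by `rfl` to the registered signature of its stub. -/
namespace Registered

/-- Alias of the statement of `stub_uniformLocalRigidity`, keyed by the registered stub name. -/
abbrev stub_uniformLocalRigidity : Prop :=
  SAWInfinitesimalRigidity.LocalRigidity →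
    ∃ ε : ℝ, 0 < ε ∧ ∀ P F : ChordalFamily,
      F.IsChordal → F.IsConformallyCovariant → F.IsRestriction → F.IsCarriedBySimpleCurves →
      P.IsChordal → P.IsRestriction → P.IsRestrictionMarkov → P.IsReversible →
      P.IsLatticeSimilarityCovariant → P.IsCarriedBySimpleCurves →
      (∀ D D' : DobrushinDomain, D'.carrier ⊆ D.carrier → D'.pt 0 = D.pt 0 → D'.pt 1 = D.pt 1 →
        |(P D (CurveClass.rangeSubset (closure D'.carrier))).toReal -
            (F D (CurveClass.rangeSubset (closure D'.carrier))).toReal| ≤ ε) →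
      P.IsConformallyCovariant

/-- Alias of the statement of `stub_chainFromCovariant`, keyed by the registered stub name. -/
abbrev stub_chainFromCovariant : Prop :=
  ∀ ε : ℝ, 0 < ε → ∀ P : ChordalFamily,
    P.IsChordal → P.IsRestriction → P.IsRestrictionMarkov → P.IsReversible →
    P.IsLatticeSimilarityCovariant → P.IsCarriedBySimpleCurves →
    ∃ (n : ℕ) (c : ℕ → ChordalFamily),
      (c 0).IsConformallyCovariant ∧ c n = P ∧
      (∀ i : ℕ, i ≤ n →
        (c i).IsChordal ∧ (c i).IsRestriction ∧ (c i).IsRestrictionMarkov ∧ (c i).IsReversible ∧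
          (c i).IsLatticeSimilarityCovariant ∧ (c i).IsCarriedBySimpleCurves) ∧
      ∀ i : ℕ, i < n → ∀ D D' : DobrushinDomain, D'.carrier ⊆ D.carrier → D'.pt 0 = D.pt 0 →
        D'.pt 1 = D.pt 1 →
        |(c (i + 1) D (CurveClass.rangeSubset (closure D'.carrier))).toReal -
            (c i D (CurveClass.rangeSubset (closure D'.carrier))).toReal| ≤ ε

end Registered

/-! ### The skeleton theorem: the two stubs imply the crux, BY NAME -/

/-- **`GlobalFromLocal` from the line `birth`** (kernel-checked, no `sorry` of its own): given
`LocalRigidity`, S1 yields a uniform `ε > 0`; for a lattice-exact `P`, S2 yields an `ε`-chain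
`c 0, …, c n = P` of lattice-exact families starting at a conformally covariant `c 0`; induction on `i ≤ n`
(one application of S1 per step, base point `c i`, unknown `c (i+1)`) shows every `c i`, in particular
`c n = P`, is conformally covariant. The inlined clauses of the crux are converted to the tree's bundles
definitionally. -/
theorem GlobalFromLocal_of (hU : Registered.stub_uniformLocalRigidity)
    (hC : Registered.stub_chainFromCovariant) :
    Summit.CriticalPhenomena.SAWScalingLimit.Theses.SAWInfinitesimalRigidity.GlobalFromLocal := by
  intro hLR P hP hres hmark hrev hsim hconj hsimple
  -- S1: the uniform absorption radius of the covariant locus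
  obtain ⟨ε, hε, habs⟩ := hU hLR
  -- the crux's inlined clauses ARE the tree bundles (definitionally)
  have hmark' : P.IsRestrictionMarkov := hmark
  have hsim' : P.IsLatticeSimilarityCovariant := ⟨hsim, hconj⟩
  have hsimple' : P.IsCarriedBySimpleCurves := hsimple
  -- S2: an ε-chain of lattice-exact families from the covariant locus to P
  obtain ⟨n, c, hc0, hcn, hcex, hstep⟩ := hC ε hε P hP hres hmark' hrev hsim' hsimple'
  -- propagation along the chain
  have key : ∀ i : ℕ, i ≤ n → (c i).IsConformallyCovariant := by
    intro i
    induction i with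
    | zero => exact fun _ => hc0
    | succ i ih =>
      intro hi
      have hi' : i ≤ n := Nat.le_of_succ_le hi
      obtain ⟨h1, h2, h3, h4, h5, h6⟩ := hcex (i + 1) hi
      obtain ⟨g1, g2, -, -, -, g6⟩ := hcex i hi'
      exact habs (c (i + 1)) (c i) g1 (ih hi') g2 g6 h1 h2 h3 h4 h5 h6 (hstep i hi)
  have hPcc := key n le_rfl
  rw [hcn] at hPcc
  exact hPcc

/-- Wiring check (an `example`, so that `GlobalFromLocal_of` stays the only theorem concluding the crux): the
registered stubs, with their tree-vocabulary types, feed the skeleton theorem as stated — this term becomes the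
crux proof when the two `sorry`s above are discharged. -/
example : Summit.CriticalPhenomena.SAWScalingLimit.Theses.SAWInfinitesimalRigidity.GlobalFromLocal :=
  GlobalFromLocal_of stub_uniformLocalRigidity stub_chainFromCovariant

end Summit.CriticalPhenomena.SAWScalingLimit.Cruxes.GlobalFromLocal.Birth

end
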